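import Literature.Geometry.Lorentzian.Development
import Literature.Geometry.Lorentzian.CausalityProofs
import HarnessLib

/-!
# The vendored `Development` structure is uninhabited (knock-on of `CausalityProofs`)

`Literature.Geometry.Lorentzian.CausalityProofs` shows that the vendored notion of Cauchy surface
`LorentzianMetric.IsCauchySurface` (O'Neill 1983, Ch. 14, Def. 14.28, rendered through the
misformalised `IsFutureInextendible`/`IsPastInextendible`) is uninhabited on every nonempty
manifold (`LorentzianMetric.IsCauchySurface.isEmpty`), and lists among the knock-on defects *not*
addressed there: "every structure field / fact asserting `IsCauchySurface … S` on a nonempty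
carrier (`Development.lean`, …) is uninhabited / false". This file records that knock-on for
`Literature.Geometry.Lorentzian.Development` in Lean, so that it is visible to every consumer:

* `Development.isEmpty_carrier`: the carrier of a development is empty (its field
  `isCauchySurface : metric.IsCauchySurface timeOrientation (range embed)`);
* `Development.elim`: there is no development of any initial data set on a connected (hence
  nonempty) data manifold `X` — the embedding `ι : X → M` would produce a point of the empty
  carrier; `Development.isEmpty`, `VacuumDevelopment.isEmpty` (theorems, deliberately not
  instances);
* consequently every named fact of the form `∀ 𝒟 : (Vacuum)Development D, …` holds vacuously
  (`Development.embedsInto_trans`, discharged here as `Development.embedsInto_trans_holds`;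
  likewise `hasCompleteFutureNullInfinity(_From)_iff_of_isIsometricTo` of `NullInfinity`/
  `Stability`, `CauchyProblem.mghd_unique`, and the consequence-form stability facts
  gr.S04–gr.S07 of `Stability.lean`, which are *not* touched here), while the existence facts
  `CauchyProblem.choquetBruhat_geroch_exists_mghd` / `choquetBruhat_local_existence`
  (`∃ 𝒟` / `Nonempty (VacuumDevelopment D)`) fail for every data set meeting their hypotheses.

**This is a defect report, not mathematics.** Choquet-Bruhat–Geroch (CMP 14 (1969), Thm. 1,
p. 331: "Every initial data set has a development") show that developments exist; the vendored
structure fails to have inhabitants only because of the dependency defect above. The faithful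
repair is a development structure over the corrected notion
`LorentzianMetric.IsCauchyHypersurface` of `Literature.Geometry.Lorentzian.Causality` (new names,
D-0014: no in-place change of meaning), after which the Development-quantified named facts of the
Lorentz prelude (`embedsInto_trans`, `hasCompleteFutureNullInfinity_iff_of_isIsometricTo`,
`hasCompleteFutureNullInfinityFrom_iff_of_isIsometricTo`, the CBG existence/uniqueness facts of
`CauchyProblem.lean`, …) must be re-vendored over it and given their printed proofs.

## References

* Y. Choquet-Bruhat, R. Geroch, *Global aspects of the Cauchy problem in general relativity*,
  Comm. Math. Phys. 14 (1969) 329–335, Thm. 1 (p. 331), Thm. 3 (p. 332).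
* B. O'Neill, *Semi-Riemannian geometry with applications to relativity*, Academic Press 1983,
  Ch. 14, Def. 14.28 (p. 415).
* H. Ringström, *The Cauchy Problem in General Relativity*, EMS 2009, Def. 16.5.
-/

noncomputable section

open Set
open scoped Manifold ContDiff

universe u

namespace Literature.Geometry.Lorentzian

variable {n : ℕ} {X : Type u} [TopologicalSpace X] [ChartedSpace (EuclideanSpace ℝ (Fin n)) X]
  [IsManifold (𝓡 n) ∞ X] [ConnectedSpace X] {D : InitialDataSet (𝓡 n) X}

namespace Development

/-- **The carrier of a (vendored) development is empty**: the field `isCauchySurface` asserts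
that `range ι` is a Cauchy surface in the vendored sense `LorentzianMetric.IsCauchySurface`,
which is uninhabited on nonempty manifolds (`LorentzianMetric.IsCauchySurface.isEmpty`,
`CausalityProofs`). Compare O'Neill 1983, Ch. 14, Def. 14.28 (the intended notion) and
Choquet-Bruhat–Geroch 1969, p. 331 (developments). [cite: ChoquetBruhatGeroch1969CMP, p. 331] -/
theorem isEmpty_carrier (𝒟 : Development D) : IsEmpty 𝒟.carrier :=
  𝒟.isCauchySurface.isEmpty

/-- **There is no development (in the vendored sense) of any initial data set on a connected data
manifold**: `X` is nonempty, so `ι : X → M` produces a point of the empty carrier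
(`isEmpty_carrier`). This contradicts the printed existence theorem (Choquet-Bruhat–Geroch 1969,
Thm. 1, p. 331: "Every initial data set has a development") and thereby exhibits the dependency
defect recorded in the module docstring; it is *not* a rendering of any printed statement.
[cite: ChoquetBruhatGeroch1969CMP, Thm. 1 (p. 331)] -/
theorem elim (𝒟 : Development D) : False :=
  𝒟.isEmpty_carrier.false (𝒟.embed (Classical.arbitrary X))

/-- The type of (vendored) developments of `D` is empty (`Development.elim`; a theorem, not
registered as an instance). Choquet-Bruhat–Geroch 1969, Thm. 1 (p. 331), for contrast. [cite: ChoquetBruhatGeroch1969CMP, Thm. 1 (p. 331)] -/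
theorem isEmpty : IsEmpty (Development D) :=
  ⟨elim⟩

/-- **Discharge of `Development.embedsInto_trans`** (Ringström 2009, Def. 16.5: embeddings of
developments compose) — *vacuous* under the vendored definitions: there are no developments
(`Development.elim`), so the universally quantified statement holds trivially; the printed
argument (chain rule `pullbackBilin_comp` and the timecone lemma) is not exercised. [cite: Ringstrom2009, Def. 16.5] -/
theorem embedsInto_trans_holds (D : InitialDataSet (𝓡 n) X) : embedsInto_trans D :=
  fun {𝒟₁} _ _ _ _ ↦ 𝒟₁.elim.elim

end Development

namespace VacuumDevelopment

/-- The type of (vendored) vacuum developments of `D` is empty (`Development.elim`; a theorem,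
not registered as an instance). Choquet-Bruhat–Geroch 1969, Thm. 1 (p. 331), for contrast. [cite: ChoquetBruhatGeroch1969CMP, Thm. 1 (p. 331)] -/
theorem isEmpty : IsEmpty (VacuumDevelopment D) :=
  ⟨fun 𝒟 ↦ 𝒟.toDevelopment.elim⟩

end VacuumDevelopment

end Literature.Geometry.Lorentzian

end
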